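import Summits.CriticalPhenomena.PercolationContinuityZ3.Theorems.PercNearOneGluingNoHeavyLowerTailThreePartitionGridOrOrTwistedMatching
import Summits.CriticalPhenomena.PercolationContinuityZ3.Theorems.PercNearOneGluingNoHeavyLowerTailThreePartitionCylinderHall
import Summits.CriticalPhenomena.PercolationContinuityZ3.Theorems.PercNearOneGluingNoHeavyLowerTailThreePartitionVOrderNested
import Summits.CriticalPhenomena.PercolationContinuityZ3.Theorems.PercNearOneGluingNoHeavyLowerTailThreePartitionCombBridge
import HarnessLib.Audit

/-!
# `NoHeavyLowerTail` (crux stmt-CriticalPhenomena-4575), master-family hierarchy P3 (gen 36): TWO DISJUNCTIONS, EVERY TWIST — the consequences: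
# grid transport, `ThreePartitionPositivityTwisted` on the class, and Sahi's `E₃ ≥ 0` (comb-positive) for (increasing event, OR, OR)

Support file (seat `prim-masterthm-p3`; `--supports stmt-CriticalPhenomena-4575`; memo
`run/shared/lean/prim/prim-masterthm/FROM-prim-masterthm-p3-g36-CYLINDER-SLACK.md` §10).  From `typedMatchable_orOrT` (`…GridOrOrTwistedMatching`):
* `sum_gtKernel_nonneg_orOrT` — the `GridTransport` inequality `∑_{q∈𝒰} κ_{τ,OR P,OR Q}(q) ≥ 0` for every twist and every grid up-set `𝒰`;
* `threePartNT_orOr_nonneg` — `N_τ(𝒰, OR P, OR Q) ≥ 0` for every twist `τ`, every up-set `𝒰`, all `P, Q` (cylinders, `threePartNT_eq_sum_filter`);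
  `threePartNT_nonneg_of_two_or` — the same with the two disjunctions in any two slots (`threePartNT_swap12/23`); `threePartNT_nonneg_of_univ_or_or`
  — slots 2, 3 in `{⊤} ∪ {OR P}` (with `⊤` the nested class `…VOrderNested` applies);
* **`combPos_sahiE_three_orOr`** / **`sahiE_three_orOr_nonneg`** — through the bridge `…ThreePartitionCombBridge` (`combCoef3_eq_threePartNT`: the
  tensor-Bernstein coefficient of `E₃` at a profile is the twisted functional of the SECTIONS; the sections of a disjunction are `⊤` or a disjunction,
  `secFam_orFam`): for every finite `α`, every increasing `U ⊆ 2^α`, all `P, Q ⊆ α`, the function `p ↦ E₃(μ_p; 1_U, 1_{OR P}, 1_{OR Q})` is a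
  nonnegative combination of the degree-3 tensor-Bernstein basis, in particular `≥ 0` under every product measure — COMB-C3 (hence Sahi's `C₃` on
  product measures) for the class of triples with two disjunctions.
HONEST LABEL: this closes COMB-C3 on ONE class (an arbitrary increasing event against two disjunctions); it needs all twists, which is why the twisted
matching was built.  `TypedGridMatching` / `GridTransport` / COMB-C3 / Sahi's `C₃` for three general increasing events remain OPEN; the class may
overlap the OR-coin closure results of the H-MIX files (different method: an explicit injection, no certificates); nothing bears on the (closed) crux.
[this work]
-/

noncomputable section

open Finset
open scoped symmDiff Classical

namespace Summit.CriticalPhenomena.PercolationContinuityZ3.Theorems.ThreePartition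

variable {ι : Type*} [Fintype ι]

/-! ## Consequences: grid transport and twisted three-partition positivity for two disjunctions, every twist -/

/-- **Grid transport for `(τ, OR P, OR Q)`**: `∑_{q∈𝒰} κ_{τ,OR P,OR Q}(q) ≥ 0` for every family `𝒰` closed upwards in the grid order. [this work] -/
theorem sum_gtKernel_nonneg_orOrT (τ P Q : Set ι) {𝒰 : Set (Set ι × Set ι)}
    (h𝒰 : ∀ q q' : Set ι × Set ι, q ∈ 𝒰 → q.1 ∆ τ ⊆ q'.1 ∆ τ → q'.2 ∆ τ ⊆ q.2 ∆ τ → q' ∈ 𝒰) :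
    0 ≤ ∑ q ∈ (cfgs ι).filter (fun q => q ∈ 𝒰), gtKernel τ (orFam P) (orFam Q) q :=
  sum_gtKernel_nonneg_of_gtMatchable (gtMatchable_orOrT τ P Q) h𝒰

/-- **`N_τ(𝒰, OR P, OR Q) ≥ 0`** for every twist `τ`, every up-set `𝒰` and all `P, Q`. [this work] -/
theorem threePartNT_orOr_nonneg (τ : Set ι) {𝒰 : Set (Set ι)} (h𝒰 : IsUpperSet 𝒰) (P Q : Set ι) :
    0 ≤ threePartNT τ 𝒰 (orFam P) (orFam Q) := by
  rw [threePartNT_eq_sum_filter]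
  refine sum_gtKernel_nonneg_orOrT τ P Q fun q q' hq h1 _ => ?_
  rw [mem_cyl] at hq ⊢
  exact h𝒰 h1 hq

/-- **Twisted three-partition positivity with two disjunctions in any two slots**: `threePartNT τ 𝒰 𝒱 𝒲 ≥ 0` for every twist whenever two
of the three up-sets are disjunctions `OR(P)`, `OR(Q)` — the slice of `ThreePartitionPositivityTwisted` on this class, all twists. [this work] -/
theorem threePartNT_nonneg_of_two_or (τ : Set ι) {𝒰 𝒱 𝒲 : Set (Set ι)} (h𝒰 : IsUpperSet 𝒰) (h𝒱 : IsUpperSet 𝒱)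
    (h𝒲 : IsUpperSet 𝒲)
    (h : (∃ P Q : Set ι, 𝒱 = orFam P ∧ 𝒲 = orFam Q) ∨ (∃ P Q : Set ι, 𝒰 = orFam P ∧ 𝒲 = orFam Q) ∨
      (∃ P Q : Set ι, 𝒰 = orFam P ∧ 𝒱 = orFam Q)) :
    0 ≤ threePartNT τ 𝒰 𝒱 𝒲 := by
  rcases h with ⟨P, Q, rfl, rfl⟩ | ⟨P, Q, rfl, rfl⟩ | ⟨P, Q, rfl, rfl⟩
  · exact threePartNT_orOr_nonneg τ h𝒰 P Q
  · rw [threePartNT_swap12]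
    exact threePartNT_orOr_nonneg τ h𝒱 P Q
  · rw [threePartNT_swap23, threePartNT_swap12]
    exact threePartNT_orOr_nonneg τ h𝒲 P Q

/-- The up-set `⊤` in a slot next to a disjunction: `N_τ(𝒰, 𝒱, 𝒲) ≥ 0` when `{𝒱, 𝒲} ⊆ {Set.univ} ∪ {OR(P)}` (the sections of a disjunction
are of this form). [this work] -/
theorem threePartNT_nonneg_of_univ_or_or (τ : Set ι) {𝒰 𝒱 𝒲 : Set (Set ι)} (h𝒰 : IsUpperSet 𝒰)
    (h𝒱 : 𝒱 = Set.univ ∨ ∃ P : Set ι, 𝒱 = orFam P) (h𝒲 : 𝒲 = Set.univ ∨ ∃ Q : Set ι, 𝒲 = orFam Q) :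
    0 ≤ threePartNT τ 𝒰 𝒱 𝒲 := by
  rcases h𝒱 with rfl | ⟨P, rfl⟩
  · rcases h𝒲 with rfl | ⟨Q, rfl⟩
    · exact threePartNT_nonneg_of_subset τ h𝒰 isUpperSet_univ isUpperSet_univ subset_rfl
    · exact threePartNT_nonneg_of_nested τ h𝒰 isUpperSet_univ (isUpperSet_orFam Q) (Or.inr (Or.inl (Set.subset_univ _)))
  · rcases h𝒲 with rfl | ⟨Q, rfl⟩
    · exact threePartNT_nonneg_of_subset τ h𝒰 (isUpperSet_orFam P) isUpperSet_univ (Set.subset_univ _)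
    · exact threePartNT_orOr_nonneg τ h𝒰 P Q

/-! ## Sahi's `E₃` for (increasing event, disjunction, disjunction) is comb-positive on every product cube -/

section Comb

open Literature.Combinatorics.Sahi2008
open SahiComb

variable {α : Type} [Fintype α]

/-- The section of a disjunction at a profile: all of the cube if some coordinate of `P` is open in three copies, else the disjunction
of the active coordinates of `P`. [this work] -/
theorem secFam_orFam (j : α → ℕ) (P : Set α) :
    secFam j (orFam P) = Set.univ ∨ secFam j (orFam P) = orFam {e : Act j | e.1 ∈ P} := by
  by_cases h3 : ∃ e ∈ P, j e = 3
  · left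
    obtain ⟨e, heP, he3⟩ := h3
    refine Set.eq_univ_of_forall fun T => ?_
    show liftSet j T ∈ orFam P
    rw [mem_orFam]
    refine ⟨e, ?_, heP⟩
    have hne : ¬ (j e = 1 ∨ j e = 2) := by omega
    exact (mem_liftSet_iff_of_not hne).2 he3
  · right
    have h3' : ∀ e, e ∈ P → j e ≠ 3 := fun e he h => h3 ⟨e, he, h⟩
    ext T
    show liftSet j T ∈ orFam P ↔ T ∈ orFam {e : Act j | e.1 ∈ P}
    rw [mem_orFam, mem_orFam]
    constructor
    · rintro ⟨e, heT, heP⟩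
      by_cases he : j e = 1 ∨ j e = 2
      · exact ⟨⟨e, he⟩, (mem_liftSet_iff he).1 heT, heP⟩
      · exact absurd ((mem_liftSet_iff_of_not he).1 heT) (h3' e heP)
    · rintro ⟨e, heT, heP⟩
      exact ⟨e.1, (val_mem_liftSet_iff e).2 heT, heP⟩

/-- **COMB-C3 for two disjunctions**: for every increasing event `U` and all `P, Q`, Sahi's `E₃(μ_p; 1_U, 1_{OR P}, 1_{OR Q})` is a nonnegative
combination of the degree-3 tensor-Bernstein basis on the product cube (coefficient at a profile = the twisted three-partition functional of the
sections, `combCoef3_eq_threePartNT`; the sections of a disjunction are `⊤` or a disjunction, `secFam_orFam`). [this work] -/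
theorem combPos_sahiE_three_orOr {U : Set (Set α)} (hU : IsUpperSet U) (P Q : Set α) :
    CombPos (fun _ : α => 3) (fun p => sahiE (bernoulliWeight p) 3 ![Literature.Probability.Percolation.DecisionTree.ind U, Literature.Probability.Percolation.DecisionTree.ind (orFam P),
        Literature.Probability.Percolation.DecisionTree.ind (orFam Q)]) := by
  refine combPos_sahiE_three_of_combCoef3_nonneg fun j => ?_
  by_cases hj : ∀ e, j e ≤ 3
  · rw [combCoef3_eq_threePartNT U (orFam P) (orFam Q) hj]
    have h𝒱 : secFam j (orFam P) = Set.univ ∨ ∃ P' : Set (Act j), secFam j (orFam P) = orFam P' :=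
      (secFam_orFam j P).imp id fun h => ⟨_, h⟩
    have h𝒲 : secFam j (orFam Q) = Set.univ ∨ ∃ Q' : Set (Act j), secFam j (orFam Q) = orFam Q' :=
      (secFam_orFam j Q).imp id fun h => ⟨_, h⟩
    exact_mod_cast threePartNT_nonneg_of_univ_or_or (twist j) (isUpperSet_secFam j hU) h𝒱 h𝒲
  · rw [combCoef3_eq_zero_of_not_le U (orFam P) (orFam Q) hj]

/-- **Sahi's `E₃ ≥ 0` for (increasing event, disjunction, disjunction) under every product measure.** [this work] -/
theorem sahiE_three_orOr_nonneg {U : Set (Set α)} (hU : IsUpperSet U) (P Q : Set α) (p : α → unitInterval) :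
    0 ≤ sahiE (bernoulliWeight p) 3 ![Literature.Probability.Percolation.DecisionTree.ind U, Literature.Probability.Percolation.DecisionTree.ind (orFam P),
        Literature.Probability.Percolation.DecisionTree.ind (orFam Q)] :=
  (combPos_sahiE_three_orOr hU P Q).nonneg p

end Comb

end Summit.CriticalPhenomena.PercolationContinuityZ3.Theorems.ThreePartition

end
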